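import Literature.MathematicalPhysics.QuantumFieldTheory.Balaban1983to89.B6CubeNormSuppInDecayV1
import Literature.MathematicalPhysics.QuantumFieldTheory.Balaban1983to89.B6GDVaLegKLevelV1
import Literature.MathematicalPhysics.QuantumFieldTheory.Balaban1983to89.B6HolderPairGeometryV1

/-!
# `Balaban1983to89.B6Grad2LegLettersKLevelV1` — T. Bałaban, *Propagators and renormalization transformations for lattice gauge theories. II*,
# Commun. Math. Phys. **96** (1984) 223–250 [Balaban1984PropagatorsII], Prop. 2.6 (2.138) p. 247 with (2.141) p. 247, (2.92)–(2.94) p. 239: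
# THE LETTERS OF THE `n = 0` LEG `∇_μ(h_□G_□h_□)∇*_ν` — sandwiches, the block-scale Lipschitz size of `S_νh_□`, the four-term expansion
# (split out of file (L0) `B6Grad2NormSuppLegKLevelV1` of `HOME/lit-balaban-p27/WAKE-2138-legs.md` for the 400-line cap)

statement-level skeleton of published theorems with citation tags; proofs where landed; nothing here is a claim about the Yang–Mills mass gap

PDF held: `paper:balaban1984-cmp96-propagators-rt-ii` (journal page = PDF page + 222): p. 239 [PDF 17] (the UNNUMBERED display
*"G₀ = Σ_{□∈𝒟} h_□G_□h_□"* printed between (2.90) *"G_□ = (Δ − ∂P_□∂* + Q*aQ)⁻¹"* and (2.91) *"Δ_aG₀ = I − Σ_{□,□′∈𝒟} K_{□,□′}G_{□′}h_{□′} = I − R"*;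
(2.92) line 1: the commutator of `Δ` with `h_□`; (2.94) the rescaling), p. 247 [PDF 25] ((2.138); (2.141) read for the entry `∇G∇*`: the `n = 0` term
is `Σ_□ ∇(h_□G_□h_□)∇*`).  THE SIZES OF THE CUT-OFFS `h_□` are NOT printed on p. 247 (which holds (2.133)–(2.141) only): cmp96 p. 229 [PDF 7] says
*"We construct also the corresponding family of functions h described in (1.118), and rescale them to proper scales"*, i.e. [Balaban1984PropagatorsI]
(CMP **95**) (1.118) p. 36 [PDF 20] *"h_z(x) = Π_{μ=1}^d h((x_μ − z_μ)/M₀), h ∈ C₀^∞(]−⅔, ⅔[), h(t) = 1 for t ∈ [−⅓, ⅓]"*, and the difference sizes are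
printed in [Balaban1983RegularityDecay] (CMP **89**) §2 p. 577 [PDF 7] *"|∂^ηh_j| ≤ O(M⁻¹), |Δ^ηh_j| ≤ O(M⁻²)"* (cmp96 (2.44) p. 230 carries the
resulting factor `O(M⁻¹)`).  (v1.1 docfix D-g111-2, ref-4 gen 111: the former header called the `G₀` display "(2.91)" and located the `∂h_□` size on
p. 247 — both corrected here and in the three docstrings below; no declaration touched.)

CITATION HEADER (lean-in-tree rule) — WHAT IS REPRODUCED.  Phase-2 file of the `lit-balaban` typed skeleton (HOME `run/shared/lean/pub/lit-balaban/`), seat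
**p27 gen 90** (TAKING HOME/STATUS 2026-08-24T22:31Z on p38 g34's named offer + stem TAKING 2026-08-25T03:20Z; B6 fold owner r03); SKELETON rows
**B6.Eq2.138** × B6.Eq2.141 × B6.Prop2.6 (cells only; decls of record untouched).  The leg `∇_μ(h_□G_□h_□)∇*_ν` is expanded by the lattice product rule on
both sides (p38's `…B6GradLegKLevelV1.DV_mul_mulOp`∕`mulOp_mul_EC_true`, `…B6GDVaLegKLevelV1.GDVa_sandwich_eq`) into FOUR terms (**`grad2_sandwich_eq`**,
`s = c′/L^{j₀}`): `s²·(S_μh)·E_(μ,+)G_□E_(ν,−)·(S_νh) + s·(S_μh)·E_(μ,+)G_□·(∇_νh) + s·(∇_μh)·G_□E_(ν,−)·(S_νh) + (∇_μh)·G_□·(∇_νh)`; the letters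
the leg file needs:
* §1 generic: **`hasMajorant_sandwich_in_both`** (p38's `hasMajorant_sandwich_in(_right)` with both cut-off sizes free), `hasMajorantA_mulOp_left`
  (a left factor `|f| ≤ 1` keeps an admissible-input majorant), `hasMajorantA_normSupp_of_sup` (a sup-class letter is a letter on the Hölder class
  `NormSupp blk {y′} N` whenever `N ≥ |J|`);
* §2 the cube: `supDist_shift`; **`lip_shB_hB`** — `|h_□(x + e_ν) − h_□(x′ + e_ν)| ≤ (d+1)·C1F·t(x,x′)` on admissible ordered pairs (p38's one-step
  size `…B6Partition118KLevelTorusBinders.abs_hT_sub_le_near` along the staircase `…B6BlockHolderLipschitzV1.pseudoDist_le_path`, the levels of an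
  active pair by p22's `…B6HolderPairGeometryV1.pair_levels`); `len_lip_le` (`L^{j(y)}·C1F/(8S/5) ≤ C1F` on `Q_□`); the supports and sizes of `S_νh_□`,
  `∇_νh_□`; `grad2_sandwich_eq`.
THEOREMS ONLY (no `def`, no `def … : Prop`); standard axioms.  Imports `…B6CubeNormSuppInDecayV1` (p27), `…B6GDVaLegKLevelV1` (p38),
`…B6HolderPairGeometryV1` (p22), `…B6RandomWalkInputNormChain` (p27).

HONEST SCOPE / DIVERGENCES. (1) Thresholds as in p38's legs (`M_h = Lᵃ ≥ 8`, `R ≥ 2L²`, `P′ ≥ 5`, `k ≤ m + K`, cube placed, `c′ ≠ 0`, `0 < a₀ ≤ a₁`).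
(2) The Lipschitz constant `(d+1)·C1F` of `lip_shB_hB` is ours (print: [Balaban1983RegularityDecay] p. 577 *"|∂^ηh_j| ≤ O(M⁻¹)"* per `η`-step,
rescaled to the cube's scale as cmp96 p. 229 prescribes).  (3) p38's `shB`/`DV`/`DVa` are generic in
the lattice parameters; here they are written with `(P := PV d L m K)` pinned (elaboration speed only; same terms).  NOT summit progress.
Unit `lit-balaban-p27` (gen 90), 2026-08-25.
-/

noncomputable section

open scoped BigOperators
open Finset

namespace Literature.MathematicalPhysics.QuantumFieldTheory.Balaban1983to89.B6Grad2LegLettersKLevelV1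

open LatticeFieldCalculus (supDist)
open B3TorusRadialSums (supDist_eq_sup_cdist supDist_eq_zero_iff)
open B4TorusKernel.MultiPeriod (torusSupNorm)
open B4Sect5Torus (IsPseudoDist)
open B6MultiLevelBoxOperator (N0 bigSide)
open B6MultiLevelTorusOperator (TDomains tshift unitVec one_le_of_mem)
open B6Cover236MultiLevelBlocks (cubes)
open B6Geom246MultiLevelBox (bset)
open B6Geom246MultiLevelTorus (geomT torusSupNorm_neg)
open B8Ineq192MultiLevelTorus (geomT_len)
open B6Eq238MultiLevelTorus (svec)
open B6RandomWalk (HasMajorant BlockSupp)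
open B6Prop26Gluing (mulOp mulOp_apply ind ind_nonneg ind_of_mem)
open B6GlobalChartV1 (PV toBox blkV1 domT)
open B6SectAOperatorsV1 (BondIdx)
open B6ScalarChartV1 (toBox_shift)
open B6Partition118KLevelFineSizes (C1F C1F_nonneg)
open B6Partition118KLevelTorus (hT)
open B6Partition118KLevelTorusCentral (one_le_of_four_le)
open B6Partition118KLevelTorusBinders (abs_hT_sub_le_near)
open B6Prop26KLevelSkeletonV1 (hB hB_apply ST mem_ST blkV1_mem_QT_of_hB_ne_zero)
open B6InMajorantTransplant (InMajorant)
open B6CubeWindowV1 (Placed j0 j0_le_level sc Gl)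
open B6Eq292MemberTorusV1 (EC)
open B6CubeCoeffSizesV1 (torusSupNorm_tshift_unitVec_le level_le_of_mem_QT)
open B6GradLegKLevelV1 (shB shB_apply DV DV_apply abs_DV_apply DV_mul_mulOp mulOp_mul_EC_true blkV1_mem_ST_of_hB_shift_ne_zero
  abs_hB_shift_sub_le shB_hB_deep)
open B6LapLegKLevelV1 (DVa)
open B6GDVaLegKLevelV1 (GDVa_sandwich_eq)
open B6BlockHolderLipschitzV1 (pseudoDist_le_path)
open B6HolderPairGeometryV1 (pair_levels)
open B6RandomWalkInputNorm (HasMajorantA NormSupp)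
open B6HolderNormV1 (AdmV1 tparV1 tparV1_nonneg)

/-! ## §1  Generic letters: two-sided sandwiches, bounded left factors, sup letters on the Hölder class -/

section Generic

variable {g : B6.Geometry} {X : Type}

/-- **THE SANDWICH `f·T·h` WITH BOTH FACTORS SIZED**: `T` input-localised over `S` with majorant `K ≥ 0`, `|f| ≤ s`, `|h| ≤ t`, both supported over the
blocks of `S` ⟹ `f·T·h` has the sup-class majorant `1_S(y)·1_S(y′)·(s·t·K(y,y′))` (p38's `hasMajorant_sandwich_in(_right)` with both sizes free).
[cite: Balaban1984PropagatorsII, (2.141) p.247, (2.133) p.247; derivation ours] -/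
theorem hasMajorant_sandwich_in_both (blk : X → g.Site) {T : Module.End ℝ (X → ℝ)} {f h : X → ℝ} {S : Set g.Site}
    {K : g.Site → g.Site → ℝ} {s t : ℝ} (hK : ∀ a b, 0 ≤ K a b) (hs : 0 ≤ s) (ht : 0 ≤ t)
    (hfsupp : ∀ x, f x ≠ 0 → blk x ∈ S) (hfle : ∀ x, |f x| ≤ s)
    (hhsupp : ∀ x, h x ≠ 0 → blk x ∈ S) (hhle : ∀ x, |h x| ≤ t) (hT : InMajorant blk T S K) :
    HasMajorant blk (mulOp f * T * mulOp h) (fun a b => ind S a * ind S b * (s * t * K a b)) := by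
  intro y' μ B hμ x
  beta_reduce
  have hnn : 0 ≤ ind S (blk x) * ind S y' * (s * t * K (blk x) y') * B :=
    mul_nonneg (mul_nonneg (mul_nonneg (ind_nonneg _ _) (ind_nonneg _ _)) (mul_nonneg (mul_nonneg hs ht) (hK _ _))) hμ.nonneg
  rw [Module.End.mul_apply, Module.End.mul_apply, mulOp_apply]
  by_cases hx : f x = 0
  · rw [hx, zero_mul, abs_zero]
    exact hnn
  have hxS : blk x ∈ S := hfsupp x hx
  by_cases hy : y' ∈ S
  · rw [ind_of_mem hxS, ind_of_mem hy, one_mul, one_mul, abs_mul]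
    have hμ' : BlockSupp blk (mulOp h μ) y' (t * B) := by
      refine ⟨mul_nonneg ht hμ.nonneg, fun x' hx' => ?_, fun x' hx' => ?_⟩
      · rw [mulOp_apply, abs_mul]
        exact mul_le_mul (hhle x') (hμ.bound x' hx') (abs_nonneg _) ht
      · rw [mulOp_apply, hμ.off x' hx', mul_zero]
    calc |f x| * |T (mulOp h μ) x| ≤ s * (K (blk x) y' * (t * B)) :=
          mul_le_mul (hfle x) (hT y' hy (mulOp h μ) (t * B) hμ' x) (abs_nonneg _) hs
      _ = s * t * K (blk x) y' * B := by ring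
  · have h0 : mulOp h μ = 0 := by
      funext x'
      rw [mulOp_apply, Pi.zero_apply]
      by_cases hμx : μ x' = 0
      · rw [hμx, mul_zero]
      · have hbx : blk x' = y' := by
          by_contra hne
          exact hμx (hμ.off x' hne)
        have hh0 : h x' = 0 := by
          by_contra hne
          exact hy (hbx ▸ hhsupp x' hne)
        rw [hh0, zero_mul]
    rw [h0, map_zero, Pi.zero_apply, mul_zero, abs_zero]
    exact hnn

/-- **A BOUNDED LEFT FACTOR**: `|f| ≤ 1` ⟹ `f·T` keeps every admissible-input majorant of `T`.
[cite: Balaban1984PropagatorsII, (2.141) p.247, bookkeeping] -/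
theorem hasMajorantA_mulOp_left (blk : X → g.Site) {adm : (X → ℝ) → g.Site → ℝ → Prop} {T : Module.End ℝ (X → ℝ)} {f : X → ℝ}
    {K : g.Site → g.Site → ℝ} (hfle : ∀ x, |f x| ≤ 1) (hT : HasMajorantA blk adm T K) : HasMajorantA blk adm (mulOp f * T) K := by
  intro y' μ B hμ x
  rw [Module.End.mul_apply, mulOp_apply, abs_mul]
  calc |f x| * |T μ x| ≤ 1 * (K (blk x) y' * B) :=
        mul_le_mul (hfle x) (hT y' μ B hμ x) (abs_nonneg _) zero_le_one
    _ = K (blk x) y' * B := one_mul _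

/-- **A SUP-CLASS LETTER IS A HÖLDER-CLASS LETTER ON THE BLOCK REGIONS `{y′}`** when the class size dominates `|J|`: `T ≺ K` (sup class) ⟹
`T ≺_{NormSupp blk {y′} N} K` for every `N` with `|μ(x)| ≤ N(y′, μ)`. [cite: Balaban1984PropagatorsII, (2.51) p.232 + (2.138) p.247 («+|J|»), bookkeeping] -/
theorem hasMajorantA_normSupp_of_sup (blk : X → g.Site) {N : g.Site → (X → ℝ) → ℝ} (hN : ∀ (y' : g.Site) (μ : X → ℝ) (x : X), |μ x| ≤ N y' μ)
    {T : Module.End ℝ (X → ℝ)} {K : g.Site → g.Site → ℝ} (hT : HasMajorant blk T K) :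
    HasMajorantA blk (NormSupp blk (fun y' => ({y'} : Set g.Site)) N) T K := by
  intro y' μ B hμ x
  refine hT y' μ B ⟨hμ.nonneg, fun x' _ => (hN y' μ x').trans hμ.bound, fun x' hx' => hμ.off x' ?_⟩ x
  exact fun hmem => hx' (Set.mem_singleton_iff.1 hmem)

end Generic

/-! ## §2  The cube: sizes and supports of `S_νh_□`, `∇_νh_□`; the four-term expansion -/

section Cube

variable {d ℓ : ℕ} {hd : 1 ≤ d + 1} {hL : Odd (ℓ + 1) ∧ 1 < ℓ + 1} {a₀ a₁ : ℝ} {m K : ℕ} {Mh k R : ℕ} {P' : Fin (d + 1) → ℕ}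
variable (hN : ∀ μ, N0 ℓ Mh k P' μ = (PV d ℓ m K hd hL).sitesPerDir 0) {D : TDomains d ℓ Mh k P' R} (hk : k ≤ m + K)
  (hMh1 : 1 ≤ Mh) (hP4 : ∀ μ, 4 ≤ P' μ) {a : ℕ} (hMha : Mh = (ℓ + 1) ^ a) (c : ↥(cubes D.toDomains)) (ha : a₀ ≤ a₁)

/-- shifting both points by `e_ν` does not change the sup-distance `|x − x′|_∞` of the torus. [cite: Balaban1984PropagatorsI, (1.7) p.18, bookkeeping] -/
theorem supDist_shift (s s' : Site (PV d ℓ m K hd hL) 0) (ν : Fin (d + 1)) : supDist (s.shift ν) (s'.shift ν) = supDist s s' := by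
  rw [supDist_eq_sup_cdist, supDist_eq_sup_cdist]
  congr 1
  funext μ
  by_cases h : μ = ν
  · subst h
    simp only [Site.shift, Function.update_self, add_sub_add_right_eq_sub]
  · simp only [Site.shift, Function.update_of_ne h]

include hk hMh1 hP4 hMha in
/-- **THE BLOCK-SCALE LIPSCHITZ SIZE OF `S_νh_□` ON ADMISSIBLE PAIRS**: `|h_□(x + e_ν) − h_□(x′ + e_ν)| ≤ (d+1)·C1F·t(x, x′)` for every admissible ordered pair
(`M_h = Lᵃ ≥ 8`, `R ≥ 2L²`, `P′ ≥ 5`, cube placed): along a staircase of `|x − x′|_∞` unit steps each costing `C1F/(8S/5)` (p38's `abs_hT_sub_le_near`),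
and for an ACTIVE pair both levels are `≤ j₀ + 1` (p22's `pair_levels`), so `|x − x′|_∞ = t·L^{j(y(x))} ≤ t·S`.
[cite: Balaban1983RegularityDecay, §2 p.577 («|∂^ηh_j| ≤ O(M⁻¹)»); Balaban1984PropagatorsII, p.229 ((1.118) rescaled), (2.92) p.239 (line 1),
(2.2) p.224; Balaban1984PropagatorsI, (1.118) p.36; derivation ours] -/
theorem lip_shB_hB (hM8 : 8 ≤ Mh) (hR2 : 2 * (ℓ + 1) ^ 2 ≤ R) (hP5 : ∀ μ, 5 ≤ P' μ) (hpl : Placed ℓ k P' c.1) (ν : Fin (d + 1))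
    {x x' : PBond (PV d ℓ m K hd hL) 0} (hadm : AdmV1 hN D x x') :
    |shB (P := PV d ℓ m K hd hL) ν (hB hN D c) x - shB (P := PV d ℓ m K hd hL) ν (hB hN D c) x'| ≤ (((d : ℝ) + 1) * C1F d ℓ) * tparV1 hN D x x' := by
  have hMh : 2 ≤ Mh := le_trans (by norm_num) hM8
  have hR : 2 * (ℓ + 1) ≤ R := le_trans (by nlinarith : 2 * (ℓ + 1) ≤ 2 * (ℓ + 1) ^ 2) hR2
  have hℓ1 : 1 ≤ ℓ := by have := hL.2; omega
  have hC := C1F_nonneg d ℓ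
  have ht0 := tparV1_nonneg hN D x x'
  rw [shB_apply, shB_apply]
  by_cases hact : hB hN D c ⟨x.src.shift ν, x.dir⟩ = 0 ∧ hB hN D c ⟨x'.src.shift ν, x'.dir⟩ = 0
  · rw [hact.1, hact.2, sub_zero, abs_zero]; positivity
  have hact' : hB hN D c x ≠ 0 ∨ hB hN D c ⟨x.src.shift ν, x.dir⟩ ≠ 0 ∨ hB hN D c x' ≠ 0 ∨ hB hN D c ⟨x'.src.shift ν, x'.dir⟩ ≠ 0 := by
    by_cases h1 : hB hN D c ⟨x.src.shift ν, x.dir⟩ = 0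
    · exact Or.inr (Or.inr (Or.inr fun h2 => hact ⟨h1, h2⟩))
    · exact Or.inr (Or.inl h1)
  -- the staircase bound `|h(z) − h(z′)| ≤ (d+1)·|z − z′|_∞·C1F/(8S/5)`
  set F : Site (PV d ℓ m K hd hL) 0 → ℝ := fun s => hT D c (toBox hN s) with hF
  have hPD : IsPseudoDist (fun s s' : Site (PV d ℓ m K hd hL) 0 => |F s - F s'|) :=
    ⟨fun s s' => abs_sub_comm _ _, fun s => by simp, fun s s' s'' => abs_sub_le _ _ _⟩
  have hstep : ∀ (c0 : Site (PV d ℓ m K hd hL) 0) (μ' : Fin (d + 1)), |F c0 - F (c0.shift μ')| ≤ C1F d ℓ / (8 / 5 * (bigSide ℓ Mh c.1.1 : ℝ)) := by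
    intro c0 μ'
    rw [abs_sub_comm]
    show |hT D c (toBox hN (c0.shift μ')) - hT D c (toBox hN c0)| ≤ _
    rw [toBox_shift hN]
    have h1 : ∀ i, 1 ≤ N0 ℓ Mh k P' i := one_le_of_mem (toBox hN c0).2
    refine abs_hT_sub_le_near hℓ1 hMh hR hP5 c ?_
    rw [show (toBox hN c0).1 - (tshift (N0 ℓ Mh k P') (unitVec μ') (toBox hN c0)).1 =
        -((tshift (N0 ℓ Mh k P') (unitVec μ') (toBox hN c0)).1 - (toBox hN c0).1) by abel, torusSupNorm_neg h1]
    exact torusSupNorm_tshift_unitVec_le h1 μ' _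
  have hpath := pseudoDist_le_path hPD (x.src.shift ν) (x'.src.shift ν) (B := C1F d ℓ / (8 / 5 * (bigSide ℓ Mh c.1.1 : ℝ))) (by positivity)
    (fun c0 μ' _ => hstep c0 μ')
  rw [supDist_shift] at hpath
  -- the levels of an active admissible pair
  have hlev : (blkV1 hN D x).1.1 ≤ j0 hMh1 hP4 c + 1 := by
    -- first the active point alone, then the pair
    have hdist : supDist x.src x'.src ≤ (ℓ + 1) ^ (j0 hMh1 hP4 c + 1) := by
      rcases hact' with h | h | h | h
      · have h1 := (pair_levels hN D hk (hMh1 := hMh1) (hP4 := hP4) hMha c hM8 hR2 hpl ν (x := x) (x' := x) (Or.inl h)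
          (by rw [(supDist_eq_zero_iff _ _).2 rfl]; exact Nat.zero_le _)).1.2
        exact hadm.2.1.trans (Nat.pow_le_pow_right (Nat.succ_pos ℓ) h1)
      · have h1 := (pair_levels hN D hk (hMh1 := hMh1) (hP4 := hP4) hMha c hM8 hR2 hpl ν (x := x) (x' := x) (Or.inr (Or.inl h))
          (by rw [(supDist_eq_zero_iff _ _).2 rfl]; exact Nat.zero_le _)).1.2
        exact hadm.2.1.trans (Nat.pow_le_pow_right (Nat.succ_pos ℓ) h1)
      · have h1 := (pair_levels hN D hk (hMh1 := hMh1) (hP4 := hP4) hMha c hM8 hR2 hpl ν (x := x') (x' := x') (Or.inl h)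
          (by rw [(supDist_eq_zero_iff _ _).2 rfl]; exact Nat.zero_le _)).1.2
        exact hadm.2.2.trans (Nat.pow_le_pow_right (Nat.succ_pos ℓ) h1)
      · have h1 := (pair_levels hN D hk (hMh1 := hMh1) (hP4 := hP4) hMha c hM8 hR2 hpl ν (x := x') (x' := x') (Or.inr (Or.inl h))
          (by rw [(supDist_eq_zero_iff _ _).2 rfl]; exact Nat.zero_le _)).1.2
        exact hadm.2.2.trans (Nat.pow_le_pow_right (Nat.succ_pos ℓ) h1)
    exact (pair_levels hN D hk (hMh1 := hMh1) (hP4 := hP4) hMha c hM8 hR2 hpl ν hact' hdist).1.2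
  -- `|x − x′|_∞ = t·L^{j(y(x))}` and `L^{j(y(x))} ≤ L^{j₀+1} ≤ S`
  have hL0 : (0 : ℝ) < (((ℓ + 1 : ℕ) : ℝ)) ^ (blkV1 hN D x).1.1 := by positivity
  have hDt : ((supDist x.src x'.src : ℕ) : ℝ) = tparV1 hN D x x' * (((ℓ + 1 : ℕ) : ℝ)) ^ (blkV1 hN D x).1.1 := by
    unfold tparV1; rw [div_mul_cancel₀ _ hL0.ne']
  have hS : (((ℓ + 1 : ℕ) : ℝ)) ^ (blkV1 hN D x).1.1 ≤ (bigSide ℓ Mh c.1.1 : ℝ) := by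
    have hj := (j0_le_level hMh1 hP4 c hL hR2).1
    unfold bigSide; push_cast
    have hL1 : (1 : ℝ) ≤ (ℓ : ℝ) + 1 := by linarith [Nat.cast_nonneg (α := ℝ) ℓ]
    have hM : (1 : ℝ) ≤ Mh := by exact_mod_cast hMh1
    have h1 : ((ℓ : ℝ) + 1) ^ (blkV1 hN D x).1.1 ≤ ((ℓ : ℝ) + 1) ^ (c.1.1 + 1) := pow_le_pow_right₀ hL1 (by omega)
    calc ((ℓ : ℝ) + 1) ^ (blkV1 hN D x).1.1 ≤ ((ℓ : ℝ) + 1) ^ (c.1.1 + 1) := h1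
      _ ≤ (Mh : ℝ) * ((ℓ : ℝ) + 1) ^ (c.1.1 + 1) := le_mul_of_one_le_left (by positivity) hM
  have hS0 : (0 : ℝ) < (bigSide ℓ Mh c.1.1 : ℝ) := lt_of_lt_of_le hL0 hS
  calc |hB hN D c ⟨x.src.shift ν, x.dir⟩ - hB hN D c ⟨x'.src.shift ν, x'.dir⟩|
      = |F (x.src.shift ν) - F (x'.src.shift ν)| := by simp only [hF, hB_apply]
    _ ≤ ((PV d ℓ m K hd hL).d : ℝ) * (supDist x.src x'.src : ℝ) * (C1F d ℓ / (8 / 5 * (bigSide ℓ Mh c.1.1 : ℝ))) := hpath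
    _ = ((d : ℝ) + 1) * (tparV1 hN D x x' * (((ℓ + 1 : ℕ) : ℝ)) ^ (blkV1 hN D x).1.1) *
          (C1F d ℓ / (8 / 5 * (bigSide ℓ Mh c.1.1 : ℝ))) := by
        rw [hDt]; norm_cast
    _ = ((d : ℝ) + 1) * C1F d ℓ * tparV1 hN D x x' *
          ((((ℓ + 1 : ℕ) : ℝ)) ^ (blkV1 hN D x).1.1 / (8 / 5 * (bigSide ℓ Mh c.1.1 : ℝ))) := by ring
    _ ≤ ((d : ℝ) + 1) * C1F d ℓ * tparV1 hN D x x' * 1 := by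
        refine mul_le_mul_of_nonneg_left ?_ (by positivity)
        rw [div_le_one (by positivity)]
        nlinarith
    _ = ((d : ℝ) + 1) * C1F d ℓ * tparV1 hN D x x' := mul_one _

/-- **`(L^{j(y)})·C1F/(8S/5) ≤ C1F` ON `Q^T_□`** (levels of the reach `≤ j(□) + 1`, `S = M_h L^{j(□)+1}`, `M_h ≥ 1`): the small multiplier `∇h_□` eats one
length. [cite: Balaban1983RegularityDecay, §2 p.577 («|∂^ηh_j| ≤ O(M⁻¹)»); Balaban1984PropagatorsII, p.229 ((1.118) rescaled), (2.1) p.224, bookkeeping] -/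
theorem len_lip_le (hR : 2 * (ℓ + 1) ≤ R) {y : (geomT D).Site} (hy : y ∈ ST D hMh1 hP4 c) :
    (geomT D).len y * (C1F d ℓ / (8 / 5 * (bigSide ℓ Mh c.1.1 : ℝ))) ≤ C1F d ℓ := by
  have hC := C1F_nonneg d ℓ
  have hlev := level_le_of_mem_QT hMh1 hP4 c hR ((mem_ST D hMh1 hP4 c y).1 hy)
  have hL1 : (1 : ℝ) ≤ (ℓ : ℝ) + 1 := by linarith [Nat.cast_nonneg (α := ℝ) ℓ]
  have hM : (1 : ℝ) ≤ Mh := by exact_mod_cast hMh1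
  have hlen : (geomT D).len y ≤ (bigSide ℓ Mh c.1.1 : ℝ) := by
    rw [geomT_len, mul_one]
    unfold bigSide; push_cast
    calc ((ℓ : ℝ) + 1) ^ y.1.1 ≤ ((ℓ : ℝ) + 1) ^ (c.1.1 + 1) := pow_le_pow_right₀ hL1 hlev
      _ ≤ (Mh : ℝ) * ((ℓ : ℝ) + 1) ^ (c.1.1 + 1) := le_mul_of_one_le_left (by positivity) hM
  have hS0 : (0 : ℝ) < (bigSide ℓ Mh c.1.1 : ℝ) := by
    have := B6CubeWindowV1.one_le_bigSide_real (ℓ := ℓ) hMh1 c.1.1; linarith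
  have hlen0 : 0 ≤ (geomT D).len y := by rw [geomT_len]; positivity
  calc (geomT D).len y * (C1F d ℓ / (8 / 5 * (bigSide ℓ Mh c.1.1 : ℝ)))
      = C1F d ℓ * ((geomT D).len y / (8 / 5 * (bigSide ℓ Mh c.1.1 : ℝ))) := by ring
    _ ≤ C1F d ℓ * 1 := by
        refine mul_le_mul_of_nonneg_left ?_ hC
        rw [div_le_one (by positivity)]
        nlinarith
    _ = C1F d ℓ := mul_one _

/-- the support of `S_νh_□` lies over the blocks of `Q^T_□`. [cite: Balaban1984PropagatorsII, p.235, p.239, bookkeeping] -/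
theorem supp_shB_hB (hM8 : 8 ≤ Mh) (hR : 2 * (ℓ + 1) ≤ R) (hP5 : ∀ μ, 5 ≤ P' μ) (ν : Fin (d + 1)) :
    ∀ b, shB (P := PV d ℓ m K hd hL) ν (hB hN D c) b ≠ 0 → blkV1 hN D b ∈ ST D hMh1 hP4 c :=
  fun b hb => blkV1_mem_ST_of_hB_shift_ne_zero hN hMh1 hP4 c hM8 hR hP5 ν (by simpa [shB_apply] using hb)

/-- the support of `∇_νh_□` lies over the blocks of `Q^T_□`. [cite: Balaban1984PropagatorsII, p.235, p.239, bookkeeping] -/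
theorem supp_DV_hB (hMh : 2 ≤ Mh) (hM8 : 8 ≤ Mh) (hR : 2 * (ℓ + 1) ≤ R) (hP5 : ∀ μ, 5 ≤ P' μ) (cf : ℝ) (ν : Fin (d + 1)) :
    ∀ b, DV (P := PV d ℓ m K hd hL) ν cf (hB hN D c) b ≠ 0 → blkV1 hN D b ∈ ST D hMh1 hP4 c := by
  intro b hb
  by_cases h1 : hB hN D c ⟨b.src.shift ν, b.dir⟩ ≠ 0
  · exact blkV1_mem_ST_of_hB_shift_ne_zero hN hMh1 hP4 c hM8 hR hP5 ν h1
  · have h2 : hB hN D c b ≠ 0 := by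
      intro h0; apply hb; rw [DV_apply, not_not.1 h1, h0]; ring
    exact (mem_ST D hMh1 hP4 c _).2 (blkV1_mem_QT_of_hB_ne_zero hN D hMh hR hP4 c h2)

/-- `|∇_νh_□| ≤ |c′|·C1F/(8S/5)`. [cite: Balaban1983RegularityDecay, §2 p.577 («|∂^ηh_j| ≤ O(M⁻¹)»); Balaban1984PropagatorsII, p.229 ((1.118) rescaled),
bookkeeping] -/
theorem abs_DV_hB_le (hMh : 2 ≤ Mh) (hR : 2 * (ℓ + 1) ≤ R) (hP5 : ∀ μ, 5 ≤ P' μ) (cf : ℝ) (ν : Fin (d + 1))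
    (b : PBond (PV d ℓ m K hd hL) 0) : |DV (P := PV d ℓ m K hd hL) ν cf (hB hN D c) b| ≤ |cf| * (C1F d ℓ / (8 / 5 * (bigSide ℓ Mh c.1.1 : ℝ))) := by
  rw [abs_DV_apply]
  exact mul_le_mul_of_nonneg_left (abs_hB_shift_sub_le hN c hMh hR hP5 ν b) (abs_nonneg _)

include hMha in
/-- **THE FOUR-TERM EXPANSION OF THE `n = 0` LEG** (`s = c′/L^{j₀}`):
`∇_μ(h_□G_□h_□)∇*_ν = s²·(S_μh)E_(μ,+)G_□E_(ν,−)(S_νh) + s·(S_μh)E_(μ,+)G_□(∇_νh) + s·(∇_μh)G_□E_(ν,−)(S_νh) + (∇_μh)G_□(∇_νh)`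
(all cut-offs as multiplications).
[cite: Balaban1984PropagatorsII, (2.141) p.247 (n = 0), (2.92) p.239 (line 1), (2.94) p.239] -/
theorem grad2_sandwich_eq (ha₀ : 0 < a₀) (hM8 : 8 ≤ Mh) (hR2 : 2 * (ℓ + 1) ^ 2 ≤ R) (hpl : Placed ℓ k P' c.1)
    (w : BondIdx (domT hN D hk) → ℝ) {cf : ℝ} (hcf : cf ≠ 0) (μ ν : Fin (d + 1)) :
    DV (P := PV d ℓ m K hd hL) μ cf * (mulOp (hB hN D c) * Gl hN hk hMh1 hP4 hMha c ha hpl w cf * mulOp (hB hN D c)) * DVa (P := PV d ℓ m K hd hL) ν cf =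
      sc hMh1 hP4 c cf •
          (mulOp (shB (P := PV d ℓ m K hd hL) μ (hB hN D c)) *
            (EC hN hk hMh1 hP4 hMha c ha hpl w cf (μ, true) * Gl hN hk hMh1 hP4 hMha c ha hpl w cf * EC hN hk hMh1 hP4 hMha c ha hpl w cf (ν, false) *
              mulOp (shB (P := PV d ℓ m K hd hL) ν (hB hN D c)))) +
        (cf / (((ℓ + 1 : ℕ) : ℝ)) ^ j0 hMh1 hP4 c) •
          (mulOp (shB (P := PV d ℓ m K hd hL) μ (hB hN D c)) * (EC hN hk hMh1 hP4 hMha c ha hpl w cf (μ, true) * Gl hN hk hMh1 hP4 hMha c ha hpl w cf) *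
            mulOp (DV (P := PV d ℓ m K hd hL) ν cf (hB hN D c))) +
        (cf / (((ℓ + 1 : ℕ) : ℝ)) ^ j0 hMh1 hP4 c) •
          (mulOp (DV (P := PV d ℓ m K hd hL) μ cf (hB hN D c)) * (Gl hN hk hMh1 hP4 hMha c ha hpl w cf * EC hN hk hMh1 hP4 hMha c ha hpl w cf (ν, false)) *
            mulOp (shB (P := PV d ℓ m K hd hL) ν (hB hN D c))) +
        mulOp (DV (P := PV d ℓ m K hd hL) μ cf (hB hN D c)) * Gl hN hk hMh1 hP4 hMha c ha hpl w cf * mulOp (DV (P := PV d ℓ m K hd hL) ν cf (hB hN D c)) := by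
  have hLj : ((((ℓ + 1 : ℕ) : ℝ)) ^ j0 hMh1 hP4 c) ≠ 0 := by positivity
  have hright := GDVa_sandwich_eq hN hk hMh1 hP4 hMha c ha ha₀ hM8 hR2 hpl w hcf ν
  have hprod := DV_mul_mulOp μ cf (hB hN D c)
  have key := mulOp_mul_EC_true hN hk hMh1 hP4 hMha c ha hpl w hcf μ (shB (P := PV d ℓ m K hd hL) μ (hB hN D c))
    (fun b hb => shB_hB_deep hN hk hMh1 hP4 hMha c ha hM8 hR2 hpl w cf μ b hb)
  unfold sc
  -- atoms
  generalize EC hN hk hMh1 hP4 hMha c ha hpl w cf (μ, true) = Ep at key ⊢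
  generalize EC hN hk hMh1 hP4 hMha c ha hpl w cf (ν, false) = Em at hright ⊢
  generalize Gl hN hk hMh1 hP4 hMha c ha hpl w cf = G at hright ⊢
  generalize mulOp (shB (P := PV d ℓ m K hd hL) μ (hB hN D c)) = Sm at key hprod ⊢
  generalize mulOp (shB (P := PV d ℓ m K hd hL) ν (hB hN D c)) = Sn at hright ⊢
  generalize mulOp (DV (P := PV d ℓ m K hd hL) μ cf (hB hN D c)) = Dm at hprod ⊢
  generalize mulOp (DV (P := PV d ℓ m K hd hL) ν cf (hB hN D c)) = Dn at hright ⊢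
  generalize mulOp (hB hN D c) = Hm at hright hprod ⊢
  generalize DV (P := PV d ℓ m K hd hL) μ cf = Dv at key hprod ⊢
  generalize DVa (P := PV d ℓ m K hd hL) ν cf = Dva at hright ⊢
  -- `(S_μh)·∇_μ = s•(S_μh)·E_(μ,+)`
  have key' : Sm * Dv = (cf / (((ℓ + 1 : ℕ) : ℝ)) ^ j0 hMh1 hP4 c) • (Sm * Ep) := by
    rw [key, smul_smul, div_mul_div_comm, mul_comm cf, div_self (mul_ne_zero hLj hcf), one_smul]
  generalize (cf / (((ℓ + 1 : ℕ) : ℝ)) ^ j0 hMh1 hP4 c) = s at hright key' ⊢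
  calc Dv * (Hm * G * Hm) * Dva = Dv * (Hm * G * Hm * Dva) := by simp only [mul_assoc]
    _ = Dv * (s • (Hm * (G * Em) * Sn) + Hm * G * Dn) := by rw [hright]
    _ = s • ((Dv * Hm) * (G * Em) * Sn) + (Dv * Hm) * G * Dn := by
        rw [mul_add, mul_smul_comm]; simp only [mul_assoc]
    _ = s • ((Sm * Dv + Dm) * (G * Em) * Sn) + (Sm * Dv + Dm) * G * Dn := by rw [hprod]
    _ = s • ((s • (Sm * Ep) + Dm) * (G * Em) * Sn) + (s • (Sm * Ep) + Dm) * G * Dn := by rw [key']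
    _ = _ := by
        simp only [add_mul, smul_mul_assoc, smul_add, smul_smul, mul_assoc, pow_two]
        abel

end Cube

end Literature.MathematicalPhysics.QuantumFieldTheory.Balaban1983to89.B6Grad2LegLettersKLevelV1

end
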